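import Literature.MathematicalPhysics.QuantumFieldTheory.Balaban1983to89.B9Thm314GpFlatEntries
import Literature.MathematicalPhysics.QuantumFieldTheory.Balaban1983to89.B9Thm314GpFlatDualHolder

/-!
# `Balaban1983to89.B9Thm314GpFlatAll` — [B9] THEOREM 3.14 (pp. 426–427, (3.154)) AT `U = 1` FOR `G′ = Δ′_a⁻¹` ON THE
GENUINE `k`-LEVEL TORUS: ALL SIX CHARACTERISTIC INEQUALITIES OF [4] (2.67) (= [B9] (3.42) + the p. 398 remark + (3.43))
FOR THE DIFFERENCE OF TWO FAMILIES, WITH ONE SET OF CONSTANTS — the single printed sentence «their difference satisfies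
all the inequalities characteristic for operators of the considered type, with the additional factor exp(−δ₀d(y, y′, Ω))»
for the operator `G′` at `U = 1` (a packaging leaf over files 3–6; no existing module is touched; no fact is minted)

FRAMING (verbatim cell line):
statement-level skeleton of published theorems with citation tags; proofs where landed; nothing here is a claim about the Yang–Mills mass gap

Sources under audit (cell pub-balaban / lit-balaban): T. Bałaban, *Propagators for lattice gauge theories in a
background field*, Commun. Math. Phys. **99** (1985) 389–434 [`Balaban1985BackgroundPropagators`, "B9"], pp. 426–427
(Theorem 3.14, (3.154)), pp. 397–398 ((3.42), (3.43) and the remark on `∇_U`, `∇*_U`); T. Bałaban, *Propagators and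
renormalization transformations for lattice gauge theories. II*, Commun. Math. Phys. **96** (1984) 223–250
[`Balaban1984PropagatorsII`, "[4]"], Prop. 2.2 (2.67) p. 234.  Unit `lit-balaban-p21` (Phase-2 proof seat p21 gen 18,
HOME `run/shared/lean/pub/lit-balaban/`; B9 fold owner r06, B6 fold owner r03, referee ref-4).

## WHAT THIS FILE CERTIFIES (kernel-checked; lattice units; setting of files 1–6 `B9Thm314GpFlat…`)

**`thm314_Gp_all_flat_multiLevelTorus`** — for every `0 ≤ α < 1` there are `δ, C, M₀ > 0`, `N₀ ≥ 1` (`k`-uniform,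
uniform in `μ`, independent of the two families; `C` depends on `α`) such that for all admissible `k, M_h, R, P`, every
two torus families `D, D′`, windowed weights, common TOP blocks `y = B^k(p)`, `y′ = B^k(q)`, `supp λ ⊂ B^k(q)`, `|λ| ≤ B`,
with `E := e^{−δ·min(d_D,d_{D′})(y,y′)}·e^{−δ·d(y,y′,Ω)}`:
for every `x ∈ B^k(p)`: `|((G′[D] − G′[D′])λ)(x)| ≤ C·L^{2k}·E·B`, `|(∇_μ(…)λ)(x)|, |((…)∇_μ*λ)(x)| ≤ C·L^k·E·B`,
`|(Δ(…)λ)(x)| ≤ C·E·B`; and for every `x ≠ x′ ∈ B^k(p)`: the Hölder quotients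
`|x′−x|_T^{−α}·|second difference of ∇_μ(…)λ|, |x′−x|_T^{−α}·|((…)∇_μ*λ)(x′) − ((…)∇_μ*λ)(x)| ≤ C·(L^k)^{1−α}·E·B`
(files 4, 5, 6 by name, constants merged by `weaken_consts`); **`thm314_holder_flat_nonvacuous`** — the Hölder clauses
are not vacuous: admissible data with a common top block containing two distinct sites exist for every `k ≥ 1`.

## HONEST SCOPE

As files 3–6: `U = 1`, the operator `G′` only, the sup and Hölder members of [4] (2.67) (not the `L²` members (3.46),
not (3.44)–(3.45), not the other operators of Theorem 3.14); torus lineage setting; (3.154) = file 1's `dOmega`;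
`min(d_D, d_{D′})` in the characteristic factor; a different (resolvent) proof of the printed statement on a model
family, declared.  Nothing is inferred from the manuscript: every step is kernel-checked.
-/

namespace Literature.MathematicalPhysics.QuantumFieldTheory.Balaban1983to89.B9Thm314GpFlatAll

open Finset Matrix
open Literature.MathematicalPhysics.QuantumFieldTheory.Balaban1983to89.B4Reflection242 (boxDom mem_boxDom blk)
open Literature.MathematicalPhysics.QuantumFieldTheory.Balaban1983to89.B4TorusKernel.MultiPeriod (torusSupNorm)
open Literature.MathematicalPhysics.QuantumFieldTheory.Balaban1983to89.B6MultiLevelBoxOperator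
open Literature.MathematicalPhysics.QuantumFieldTheory.Balaban1983to89.B6MultiLevelTorusOperator
open Literature.MathematicalPhysics.QuantumFieldTheory.Balaban1983to89.B6Geom246MultiLevelBox
open Literature.MathematicalPhysics.QuantumFieldTheory.Balaban1983to89.B6Geom246MultiLevelTorus
open Literature.MathematicalPhysics.QuantumFieldTheory.Balaban1983to89.B6Prop22DerivMultiLevelTorus (dT)
open Literature.MathematicalPhysics.QuantumFieldTheory.Balaban1983to89.B6RandomWalk (BlockSupp)
open Literature.MathematicalPhysics.QuantumFieldTheory.Balaban1983to89.B6Ineq243TwoLevelBox (aNext)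
open Literature.MathematicalPhysics.QuantumFieldTheory.Balaban1983to89.B9Thm314GpFlatTorusGeometry
open Literature.MathematicalPhysics.QuantumFieldTheory.Balaban1983to89.B9Thm314GpFlatResolvent
open Literature.MathematicalPhysics.QuantumFieldTheory.Balaban1983to89.B9Thm314GpFlatMultiLevelTorus
open Literature.MathematicalPhysics.QuantumFieldTheory.Balaban1983to89.B9Thm314GpFlatEntries
open Literature.MathematicalPhysics.QuantumFieldTheory.Balaban1983to89.B9Thm314GpFlatHolder
open Literature.MathematicalPhysics.QuantumFieldTheory.Balaban1983to89.B9Thm314GpFlatDualHolder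

noncomputable section

variable {d : ℕ}

/-- **[B9] THEOREM 3.14 AT `U = 1` FOR `G′`: ALL SIX ENTRIES OF [4] (2.67) FOR THE DIFFERENCE, ONE SET OF CONSTANTS.**
[cite: Balaban1985BackgroundPropagators, Thm 3.14 (3.154) pp.426–427, (3.42)–(3.43) pp.397–398; Balaban1984PropagatorsII, Prop. 2.2 (2.67) p.234] -/
theorem thm314_Gp_all_flat_multiLevelTorus (d ℓ : ℕ) (hℓ : 1 ≤ ℓ) (aminus aplus a2minus a2plus : ℝ) (ha : 0 < aminus)
    (ha2 : 0 < a2minus) (α : ℝ) (hα0 : 0 ≤ α) (hα1 : α < 1) :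
    ∃ δ C M₀ : ℝ, ∃ N₀ : ℕ, 0 < δ ∧ 0 < C ∧ 0 < M₀ ∧ 0 < N₀ ∧
      ∀ (k Mh R : ℕ), 3 ≤ Mh → M₀ ≤ ((ℓ : ℝ) + 1) * Mh → 2 * (ℓ + 1) ≤ R → N₀ + 1 ≤ R * ((ℓ + 1) * Mh) →
      ∀ (P : Fin (d + 1) → ℕ) (hP : ∀ μ, 1 ≤ P μ) (hP4 : ∀ μ, 4 ≤ P μ) (D D' : TDomains d ℓ Mh k P R)
        (a c : ℕ → ℝ), (∀ i, 1 ≤ i → aminus ≤ a i ∧ a i ≤ aplus) → (∀ i, 1 ≤ i → a2minus ≤ c i ∧ c i ≤ a2plus) →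
        (∀ i, 1 ≤ i → a (i + 1) = aNext ℓ (a i) (c i)) →
      ∀ (p q : ℕ × (Fin (d + 1) → ℤ)) (hpD : p ∈ bset D.toDomains) (hpD' : p ∈ bset D'.toDomains)
        (hqD : q ∈ bset D.toDomains) (hqD' : q ∈ bset D'.toDomains), p.1 = k → q.1 = k →
      ∀ (lam : ↥(boxDom (N0 ℓ Mh k P)) → ℝ) (B : ℝ),
        BlockSupp (g := geomT D) (blkOf D.toDomains) lam ⟨q, hqD⟩ B →
      (∀ x : ↥(boxDom (N0 ℓ Mh k P)), blkOf D.toDomains x = ⟨p, hpD⟩ →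
        |((gmlT (N0 ℓ Mh k P) ℓ k D.lev a - gmlT (N0 ℓ Mh k P) ℓ k D'.lev a) *ᵥ lam) x|
            ≤ C * ((ℓ : ℝ) + 1) ^ (2 * k)
              * Real.exp (-(δ * min ((geomT D).dist ⟨p, hpD⟩ ⟨q, hqD⟩) ((geomT D').dist ⟨p, hpD'⟩ ⟨q, hqD'⟩)))
              * Real.exp (-(δ * dOmega D D' p.2 q.2)) * B ∧
        (∀ μ : Fin (d + 1),
          |((dT (N0 ℓ Mh k P) μ * gmlT (N0 ℓ Mh k P) ℓ k D.lev a - dT (N0 ℓ Mh k P) μ * gmlT (N0 ℓ Mh k P) ℓ k D'.lev a)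
              *ᵥ lam) x|
            ≤ C * ((ℓ : ℝ) + 1) ^ k
              * Real.exp (-(δ * min ((geomT D).dist ⟨p, hpD⟩ ⟨q, hqD⟩) ((geomT D').dist ⟨p, hpD'⟩ ⟨q, hqD'⟩)))
              * Real.exp (-(δ * dOmega D D' p.2 q.2)) * B) ∧
        (∀ μ : Fin (d + 1),
          |((gmlT (N0 ℓ Mh k P) ℓ k D.lev a * (dT (N0 ℓ Mh k P) μ)ᵀ
              - gmlT (N0 ℓ Mh k P) ℓ k D'.lev a * (dT (N0 ℓ Mh k P) μ)ᵀ) *ᵥ lam) x|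
            ≤ C * ((ℓ : ℝ) + 1) ^ k
              * Real.exp (-(δ * min ((geomT D).dist ⟨p, hpD⟩ ⟨q, hqD⟩) ((geomT D').dist ⟨p, hpD'⟩ ⟨q, hqD'⟩)))
              * Real.exp (-(δ * dOmega D D' p.2 q.2)) * B) ∧
        |((perLapT (N0 ℓ Mh k P) * gmlT (N0 ℓ Mh k P) ℓ k D.lev a - perLapT (N0 ℓ Mh k P) * gmlT (N0 ℓ Mh k P) ℓ k D'.lev a)
            *ᵥ lam) x|
            ≤ C * Real.exp (-(δ * min ((geomT D).dist ⟨p, hpD⟩ ⟨q, hqD⟩) ((geomT D').dist ⟨p, hpD'⟩ ⟨q, hqD'⟩)))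
              * Real.exp (-(δ * dOmega D D' p.2 q.2)) * B) ∧
      (∀ (μ : Fin (d + 1)) (x x' : ↥(boxDom (N0 ℓ Mh k P))), x'.1 ≠ x.1 →
        blkOf D.toDomains x = ⟨p, hpD⟩ → blkOf D.toDomains x' = ⟨p, hpD⟩ →
        (torusSupNorm (N0 ℓ Mh k P) (x'.1 - x.1)) ^ (-α)
            * |(((gmlT (N0 ℓ Mh k P) ℓ k D.lev a - gmlT (N0 ℓ Mh k P) ℓ k D'.lev a) *ᵥ lam)
                  (tshift (N0 ℓ Mh k P) (unitVec μ) x')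
                - ((gmlT (N0 ℓ Mh k P) ℓ k D.lev a - gmlT (N0 ℓ Mh k P) ℓ k D'.lev a) *ᵥ lam) x'
                - (((gmlT (N0 ℓ Mh k P) ℓ k D.lev a - gmlT (N0 ℓ Mh k P) ℓ k D'.lev a) *ᵥ lam)
                    (tshift (N0 ℓ Mh k P) (unitVec μ) x)
                  - ((gmlT (N0 ℓ Mh k P) ℓ k D.lev a - gmlT (N0 ℓ Mh k P) ℓ k D'.lev a) *ᵥ lam) x))|
          ≤ C * (((ℓ : ℝ) + 1) ^ k) ^ (1 - α)
              * Real.exp (-(δ * min ((geomT D).dist ⟨p, hpD⟩ ⟨q, hqD⟩) ((geomT D').dist ⟨p, hpD'⟩ ⟨q, hqD'⟩)))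
              * Real.exp (-(δ * dOmega D D' p.2 q.2)) * B ∧
        (torusSupNorm (N0 ℓ Mh k P) (x'.1 - x.1)) ^ (-α)
            * |((gmlT (N0 ℓ Mh k P) ℓ k D.lev a * (dT (N0 ℓ Mh k P) μ)ᵀ
                  - gmlT (N0 ℓ Mh k P) ℓ k D'.lev a * (dT (N0 ℓ Mh k P) μ)ᵀ) *ᵥ lam) x'
              - ((gmlT (N0 ℓ Mh k P) ℓ k D.lev a * (dT (N0 ℓ Mh k P) μ)ᵀ
                  - gmlT (N0 ℓ Mh k P) ℓ k D'.lev a * (dT (N0 ℓ Mh k P) μ)ᵀ) *ᵥ lam) x|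
          ≤ C * (((ℓ : ℝ) + 1) ^ k) ^ (1 - α)
              * Real.exp (-(δ * min ((geomT D).dist ⟨p, hpD⟩ ⟨q, hqD⟩) ((geomT D').dist ⟨p, hpD'⟩ ⟨q, hqD'⟩)))
              * Real.exp (-(δ * dOmega D D' p.2 q.2)) * B) := by
  obtain ⟨δ₁, C₁, M₁, N₁, hδ₁, hC₁, hM₁, hN₁, h₁⟩ := thm314_Gp_sup_flat_multiLevelTorus d ℓ hℓ aminus aplus a2minus a2plus ha ha2
  obtain ⟨δ₂, C₂, M₂, N₂, hδ₂, hC₂, hM₂, -, h₂⟩ :=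
    thm314_dGp_holder_flat_multiLevelTorus d ℓ hℓ aminus aplus a2minus a2plus ha ha2 α hα0 hα1
  obtain ⟨δ₃, C₃, M₃, N₃, hδ₃, hC₃, hM₃, -, h₃⟩ :=
    thm314_Gpd_holder_flat_multiLevelTorus d ℓ hℓ aminus aplus a2minus a2plus ha ha2 α hα0 hα1
  refine ⟨min δ₁ (min δ₂ δ₃), max C₁ (max C₂ C₃), max M₁ (max M₂ M₃), max N₁ (max N₂ N₃),
    lt_min hδ₁ (lt_min hδ₂ hδ₃), lt_of_lt_of_le hC₁ (le_max_left _ _), lt_of_lt_of_le hM₁ (le_max_left _ _),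
    lt_of_lt_of_le hN₁ (le_max_left _ _), ?_⟩
  intro k Mh R hMh hM hR hRM P hP hP4 D D' a c haw hcw hac p q hpD hpD' hqD hqD' hp hq lam B hlam
  have hMh1 : 1 ≤ Mh := le_trans (by norm_num) hMh
  have hL0 : (0 : ℝ) < (ℓ : ℝ) + 1 := by positivity
  have hB : 0 ≤ B := hlam.nonneg
  have hm0 : 0 ≤ min ((geomT D).dist ⟨p, hpD⟩ ⟨q, hqD⟩) ((geomT D').dist ⟨p, hpD'⟩ ⟨q, hqD'⟩) :=
    le_min ((triangle_refl_nonneg_T D hMh1 hP).2.2 _ _) ((triangle_refl_nonneg_T D' hMh1 hP).2.2 _ _)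
  have hΩ0 : 0 ≤ dOmega D D' p.2 q.2 := dOmega_nonneg D D' p.2 q.2
  have hLk0 : 0 ≤ (((ℓ : ℝ) + 1) ^ k) ^ (1 - α) := Real.rpow_nonneg (by positivity) _
  have hM1 : M₁ ≤ ((ℓ : ℝ) + 1) * Mh := le_trans (le_max_left _ _) hM
  have hM2 : M₂ ≤ ((ℓ : ℝ) + 1) * Mh := le_trans ((le_max_left _ _).trans (le_max_right _ _)) hM
  have hM3 : M₃ ≤ ((ℓ : ℝ) + 1) * Mh := le_trans ((le_max_right _ _).trans (le_max_right _ _)) hM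
  have hN1' : N₁ + 1 ≤ R * ((ℓ + 1) * Mh) := le_trans (Nat.add_le_add_right (le_max_left _ _) 1) hRM
  have hN2' : N₂ + 1 ≤ R * ((ℓ + 1) * Mh) :=
    le_trans (Nat.add_le_add_right ((le_max_left _ _).trans (le_max_right _ _)) 1) hRM
  have hN3' : N₃ + 1 ≤ R * ((ℓ + 1) * Mh) :=
    le_trans (Nat.add_le_add_right ((le_max_right _ _).trans (le_max_right _ _)) 1) hRM
  have hd1 : min δ₁ (min δ₂ δ₃) ≤ δ₁ := min_le_left _ _
  have hd2 : min δ₁ (min δ₂ δ₃) ≤ δ₂ := (min_le_right _ _).trans (min_le_left _ _)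
  have hd3 : min δ₁ (min δ₂ δ₃) ≤ δ₃ := (min_le_right _ _).trans (min_le_right _ _)
  have hc1 : C₁ ≤ max C₁ (max C₂ C₃) := le_max_left _ _
  have hc2 : C₂ ≤ max C₁ (max C₂ C₃) := (le_max_left _ _).trans (le_max_right _ _)
  have hc3 : C₃ ≤ max C₁ (max C₂ C₃) := (le_max_right _ _).trans (le_max_right _ _)
  have hS := h₁ k Mh R hMh hM1 hR hN1' P hP hP4 D D' a c haw hcw hac p q hpD hpD' hqD hqD' hp hq lam B hlam
  refine ⟨fun x hx => ?_, fun μ x x' hne hx hx' => ⟨?_, ?_⟩⟩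
  · obtain ⟨s1, s2, s3, s4⟩ := hS x hx
    refine ⟨weaken_consts hd1 hC₁.le hc1 (by positivity) hm0 hΩ0 hB s1,
      fun μ => weaken_consts hd1 hC₁.le hc1 (by positivity) hm0 hΩ0 hB (s2 μ),
      fun μ => weaken_consts hd1 hC₁.le hc1 (by positivity) hm0 hΩ0 hB (s3 μ), ?_⟩
    rw [← mul_one (max C₁ (max C₂ C₃))]
    have h := s4
    rw [← mul_one C₁] at h
    exact weaken_consts hd1 hC₁.le hc1 zero_le_one hm0 hΩ0 hB h
  · exact weaken_consts hd2 hC₂.le hc2 hLk0 hm0 hΩ0 hB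
      (h₂ k Mh R hMh hM2 hR hN2' P hP hP4 D D' a c haw hcw hac p q hpD hpD' hqD hqD' hp hq lam B hlam μ x x' hne hx hx')
  · exact weaken_consts hd3 hC₃.le hc3 hLk0 hm0 hΩ0 hB
      (h₃ k Mh R hMh hM3 hR hN3' P hP hP4 D D' a c haw hcw hac p q hpD hpD' hqD hqD' hp hq lam B hlam μ x x' hne hx hx')

/-- **NON-VACUITY OF THE HÖLDER CLAUSES**: for every `M₀`, `N₀`, `k ≥ 1` there are admissible `M_h, R, P`, two torus
families and a common top block containing two DISTINCT sites (the sites `0` and `e_0` of the block of `0` in the trivial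
family `Ω₁ = … = Ω_k = T_η`; the block side is `L^k ≥ 2`). [cite: Balaban1984PropagatorsII, (2.1) p.224 («we admit the case when some domains Ω_j are equal to T_η»)] -/
theorem thm314_holder_flat_nonvacuous (d ℓ : ℕ) (hℓ : 1 ≤ ℓ) (M₀ : ℝ) (N₀ k : ℕ) (hk : 1 ≤ k) :
    ∃ (Mh R : ℕ) (P : Fin (d + 1) → ℕ) (D D' : TDomains d ℓ Mh k P R),
      3 ≤ Mh ∧ M₀ ≤ ((ℓ : ℝ) + 1) * Mh ∧ 2 * (ℓ + 1) ≤ R ∧ N₀ + 1 ≤ R * ((ℓ + 1) * Mh) ∧ (∀ μ, 4 ≤ P μ) ∧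
      ∃ (p : ℕ × (Fin (d + 1) → ℤ)) (hpD : p ∈ bset D.toDomains), p ∈ bset D'.toDomains ∧ p.1 = k ∧
        ∃ x x' : ↥(boxDom (N0 ℓ Mh k P)), x'.1 ≠ x.1 ∧ blkOf D.toDomains x = ⟨p, hpD⟩ ∧ blkOf D.toDomains x' = ⟨p, hpD⟩ := by
  obtain ⟨Mh, R, P, D, D', hMh, hM, hR, hRM, hP4, p, hpD, hpD', hp⟩ := thm314_Gp_flat_nonvacuous d ℓ M₀ N₀ k hk
  have hP : ∀ μ, 1 ≤ P μ := fun μ => le_trans (by norm_num) (hP4 μ)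
  have hMh1 : 1 ≤ Mh := le_trans (by norm_num) hMh
  refine ⟨Mh, R, P, D, D', hMh, hM, hR, hRM, hP4, p, hpD, hpD', hp, ?_⟩
  -- a site of the block and its neighbour in the direction `0` inside the block (side `L^k ≥ 2`)
  obtain ⟨x, hx⟩ := exists_blkOf_eq D.toDomains ⟨p, hpD⟩
  obtain ⟨hin, hbox, hblk⟩ := blockBox D hpD hp hx
  have hs2 : (2 : ℤ) ≤ (((ℓ + 1) ^ k : ℕ) : ℤ) := by
    have : 2 ≤ (ℓ + 1) ^ k := le_trans (by rw [pow_one]; omega : 2 ≤ (ℓ + 1) ^ 1) (Nat.pow_le_pow_right (by omega) hk)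
    exact_mod_cast this
  have hxin := hin x hx
  -- the site `z` with the `0`-th coordinate moved to the other end of the block's interval
  obtain ⟨i₀⟩ : Nonempty (Fin (d + 1)) := ⟨0⟩
  obtain ⟨zv, hzv⟩ : ∃ zv : Fin (d + 1) → ℤ, zv = fun j => if j = i₀ then
      (if x.1 i₀ = p.2 i₀ * ((ℓ + 1) ^ k : ℕ) then x.1 i₀ + 1 else x.1 i₀ - 1) else x.1 j := ⟨_, rfl⟩
  have hzin : ∀ j, p.2 j * ((ℓ + 1) ^ k : ℕ) ≤ zv j ∧ zv j ≤ p.2 j * ((ℓ + 1) ^ k : ℕ) + (((ℓ + 1) ^ k : ℕ) - 1) := by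
    intro j
    rw [hzv]
    by_cases hj : j = i₀
    · subst hj
      simp only [if_true]
      have := hxin j
      split_ifs with h0
      · constructor <;> omega
      · constructor <;> omega
    · simp only [hj, if_false]
      exact hxin j
  have hzmem : zv ∈ boxDom (N0 ℓ Mh k P) := hbox zv hzin
  refine ⟨x, ⟨zv, hzmem⟩, ?_, hx, hblk ⟨zv, hzmem⟩ hzin⟩
  intro heq
  have h := congrFun heq i₀
  simp only [hzv, if_true] at h
  split_ifs at h <;> omega

end

end Literature.MathematicalPhysics.QuantumFieldTheory.Balaban1983to89.B9Thm314GpFlatAll
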